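import Mathlib.Data.Real.Basic
import Mathlib.Tactic.Linarith
import Mathlib.Tactic.Ring
import Mathlib.Tactic.Positivity
import HarnessLib

/-!
# `NoHeavyLowerTail` (crux stmt-CriticalPhenomena-4575), P2 — β-atom algebra of the GENERAL two-step staircase member

Memo SAHI-ROUTE.md §4.23(d,e) (seat `prim-masterthm-p2`, gen 7; `--supports stmt-CriticalPhenomena-4575`).  Pure real algebra, no sums.

After the β-reduction of the triangle `(f,g,h)` of class T with `f(c,a) = φ₁(c)ψ₁(a) + (φ₂(c)−φ₁(c))ψ₂(a)` (`0 ≤ φ₁ ≤ φ₂ ≤ 1`,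
`0 ≤ ψ₂ ≤ ψ₁ ≤ 1` monotone), Sahi's `E_3(f,g,h)` is the polynomial `Atoms.E3` in 19 real "atoms": `P_i = E φ_i`, `Q_j = E ψ_j`, and the
block-`β` moments `S_{xy} = E_b[x y]`, `S_x = E_b x`, `S_y = E_b y` of the six nonnegative increasing block functions
`m = E_c[φ₁g]`, `d = E_c[(φ₂−φ₁)g]`, `n = E_c[(1−φ₂)g]`, `u = E_a[ψ₂h]`, `e = E_a[(ψ₁−ψ₂)h]`, `t = E_a[(1−ψ₁)h]`.
`Atoms.Bounds` lists what FKG on `α, β, γ` gives about them (50 linear/bilinear inequalities: signs, Chebyshev–FKG covariances on `β`,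
and the slacks `A₁ = m − P₁G ≥ 0`, `A₂ = m+d − P₂G ≥ 0`, `C₁ = u+e − Q₁H ≥ 0`, `C₂ = u − Q₂H ≥ 0` integrated against the block functions).
THIS FILE proves, from `Bounds` alone:
* `E3 = T₁ + T₂ + T₃` with `T₁, T₂ ≥ 0` and `T₃ = E[A₁]E[C₁] + E[A₂]E[C₂] − E[A₁]E[C₂]`; hence `E3 ≥ 0` when `E[A₁] ≤ E[A₂]` or `E[C₂] ≤ E[C₁]`
  (`E3_nonneg_of_EA_le`, `E3_nonneg_of_EC_le`);
* IDENTITY A (`P₂Q₁·E3 = 14 signed products`) ⇒ `E3 ≥ 0` on `(1−P₂+P₁)Q₂ ≤ P₁Q₁`; IDENTITY B (`P₁P₂Q₁·E3 = …`) ⇒ `E3 ≥ 0` on the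
  complementary part of `Q₂ ≤ P₁Q₁ + P₂Q₂`; with the `c ↔ a` swap symmetry (`Atoms.swap`, `E3_swap`, `Bounds.swap`):
  **`E3 ≥ 0` whenever `min(P₁, Q₂) ≤ P₁Q₁ + P₂Q₂`** (`E3_nonneg_of_min_le`, for `P₁, Q₂ > 0`).
The member-level theorem (sums, FKG) is in `…SahiTriangleStaircaseTwo`.  Identities found by exact LP over the atom cone and verified
symbolically (code/gen7/gen2lean.py).
-/

namespace Summit.CriticalPhenomena.PercolationContinuityZ3.Theorems

namespace SahiTriangleStaircaseTwo

/-- The 19 β-atoms of the general two-step member (see module doc). [this work] -/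
structure Atoms where
  /-- `E φ₁` -/ P1 : ℝ
  /-- `E φ₂` -/ P2 : ℝ
  /-- `E ψ₁` -/ Q1 : ℝ
  /-- `E ψ₂` -/ Q2 : ℝ
  /-- `E_b[m u]` -/ Smu : ℝ
  /-- `E_b[m e]` -/ Sme : ℝ
  /-- `E_b[m t]` -/ Smt : ℝ
  /-- `E_b[d u]` -/ Sdu : ℝ
  /-- `E_b[d e]` -/ Sde : ℝ
  /-- `E_b[d t]` -/ Sdt : ℝ
  /-- `E_b[n u]` -/ Snu : ℝ
  /-- `E_b[n e]` -/ Sne : ℝ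
  /-- `E_b[n t]` -/ Snt : ℝ
  /-- `E_b m` -/ Sm : ℝ
  /-- `E_b d` -/ Sd : ℝ
  /-- `E_b n` -/ Sn : ℝ
  /-- `E_b u` -/ Su : ℝ
  /-- `E_b e` -/ Se : ℝ
  /-- `E_b t` -/ St : ℝ

namespace Atoms

variable (z : Atoms)

/-- Sahi's `E_3` of the two-step triangle in atom form: `2E[fgh] − Ef·E[gh] − Eg·E[fh] − Eh·E[fg] + Ef·Eg·Eh` with
`E[fgh] = S_{mu}+S_{me}+S_{du}`, `Ef = P₁Q₁+(P₂−P₁)Q₂`, `E[fh] = P₁(S_u+S_e)+(P₂−P₁)S_u`, `E[fg] = Q₁S_m+Q₂S_d`. [this work] -/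
def E3 : ℝ :=
  2 * (z.Smu + z.Sme + z.Sdu)
    - (z.P1 * z.Q1 + (z.P2 - z.P1) * z.Q2) * (z.Smu + z.Sme + z.Smt + z.Sdu + z.Sde + z.Sdt + z.Snu + z.Sne + z.Snt)
    - (z.Sm + z.Sd + z.Sn) * (z.P1 * (z.Su + z.Se) + (z.P2 - z.P1) * z.Su)
    - (z.Su + z.Se + z.St) * (z.Q1 * z.Sm + z.Q2 * z.Sd)
    + (z.P1 * z.Q1 + (z.P2 - z.P1) * z.Q2) * (z.Sm + z.Sd + z.Sn) * (z.Su + z.Se + z.St)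

/-- `E_b[A₁ u]`. [this work] -/ def EA1u : ℝ := (1 - z.P1) * z.Smu - z.P1 * (z.Sdu + z.Snu)
/-- `E_b[A₁ e]`. [this work] -/ def EA1e : ℝ := (1 - z.P1) * z.Sme - z.P1 * (z.Sde + z.Sne)
/-- `E_b[A₁ t]`. [this work] -/ def EA1t : ℝ := (1 - z.P1) * z.Smt - z.P1 * (z.Sdt + z.Snt)
/-- `E_b[A₂ u]`. [this work] -/ def EA2u : ℝ := (1 - z.P2) * (z.Smu + z.Sdu) - z.P2 * z.Snu
/-- `E_b[A₂ e]`. [this work] -/ def EA2e : ℝ := (1 - z.P2) * (z.Sme + z.Sde) - z.P2 * z.Sne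
/-- `E_b[A₂ t]`. [this work] -/ def EA2t : ℝ := (1 - z.P2) * (z.Smt + z.Sdt) - z.P2 * z.Snt
/-- `E_b[A₁]`. [this work] -/ def EA1 : ℝ := (1 - z.P1) * z.Sm - z.P1 * (z.Sd + z.Sn)
/-- `E_b[A₂]`. [this work] -/ def EA2 : ℝ := (1 - z.P2) * (z.Sm + z.Sd) - z.P2 * z.Sn
/-- `E_b[C₁]`. [this work] -/ def EC1 : ℝ := (1 - z.Q1) * (z.Su + z.Se) - z.Q1 * z.St
/-- `E_b[C₂]`. [this work] -/ def EC2 : ℝ := (1 - z.Q2) * z.Su - z.Q2 * (z.Se + z.St)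
/-- `E_b[m C₁]`. [this work] -/ def EmC1 : ℝ := (1 - z.Q1) * (z.Smu + z.Sme) - z.Q1 * z.Smt
/-- `E_b[d C₁]`. [this work] -/ def EdC1 : ℝ := (1 - z.Q1) * (z.Sdu + z.Sde) - z.Q1 * z.Sdt
/-- `E_b[n C₁]`. [this work] -/ def EnC1 : ℝ := (1 - z.Q1) * (z.Snu + z.Sne) - z.Q1 * z.Snt
/-- `E_b[m C₂]`. [this work] -/ def EmC2 : ℝ := (1 - z.Q2) * z.Smu - z.Q2 * (z.Sme + z.Smt)
/-- `E_b[d C₂]`. [this work] -/ def EdC2 : ℝ := (1 - z.Q2) * z.Sdu - z.Q2 * (z.Sde + z.Sdt)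
/-- `E_b[n C₂]`. [this work] -/ def EnC2 : ℝ := (1 - z.Q2) * z.Snu - z.Q2 * (z.Sne + z.Snt)
/-- `E_b[A₁ C₁]`. [this work] -/
def EA1C1 : ℝ := (1 - z.P1) * ((1 - z.Q1) * (z.Smu + z.Sme) - z.Q1 * z.Smt)
  - z.P1 * ((1 - z.Q1) * (z.Sdu + z.Sde + z.Snu + z.Sne) - z.Q1 * (z.Sdt + z.Snt))
/-- `E_b[A₁ C₂]`. [this work] -/
def EA1C2 : ℝ := (1 - z.P1) * ((1 - z.Q2) * z.Smu - z.Q2 * (z.Sme + z.Smt))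
  - z.P1 * ((1 - z.Q2) * (z.Sdu + z.Snu) - z.Q2 * (z.Sde + z.Sdt + z.Sne + z.Snt))
/-- `E_b[A₂ C₁]`. [this work] -/
def EA2C1 : ℝ := (1 - z.P2) * ((1 - z.Q1) * (z.Smu + z.Sme + z.Sdu + z.Sde) - z.Q1 * (z.Smt + z.Sdt))
  - z.P2 * ((1 - z.Q1) * (z.Snu + z.Sne) - z.Q1 * z.Snt)
/-- `E_b[A₂ C₂]`. [this work] -/
def EA2C2 : ℝ := (1 - z.P2) * ((1 - z.Q2) * (z.Smu + z.Sdu) - z.Q2 * (z.Sme + z.Smt + z.Sde + z.Sdt))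
  - z.P2 * ((1 - z.Q2) * z.Snu - z.Q2 * (z.Sne + z.Snt))

/-- What FKG on the three blocks says about the atoms (all that the certificates use). [this work] -/
structure Bounds : Prop where
  /-- `0 ≤ P₁` -/ hP1 : 0 ≤ z.P1
  /-- `P₁ ≤ P₂` -/ hP12 : z.P1 ≤ z.P2
  /-- `P₂ ≤ 1` -/ hP2 : z.P2 ≤ 1
  /-- `0 ≤ Q₂` -/ hQ2 : 0 ≤ z.Q2
  /-- `Q₂ ≤ Q₁` -/ hQ21 : z.Q2 ≤ z.Q1
  /-- `Q₁ ≤ 1` -/ hQ1 : z.Q1 ≤ 1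
  /-- sign -/ smu : 0 ≤ z.Smu
  /-- sign -/ sme : 0 ≤ z.Sme
  /-- sign -/ smt : 0 ≤ z.Smt
  /-- sign -/ sdu : 0 ≤ z.Sdu
  /-- sign -/ sde : 0 ≤ z.Sde
  /-- sign -/ sdt : 0 ≤ z.Sdt
  /-- sign -/ snu : 0 ≤ z.Snu
  /-- sign -/ sne : 0 ≤ z.Sne
  /-- sign -/ snt : 0 ≤ z.Snt
  /-- sign -/ sm : 0 ≤ z.Sm
  /-- sign -/ sd : 0 ≤ z.Sd
  /-- sign -/ sn : 0 ≤ z.Sn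
  /-- sign -/ su : 0 ≤ z.Su
  /-- sign -/ se : 0 ≤ z.Se
  /-- sign -/ st : 0 ≤ z.St
  /-- FKG on `β` -/ cmu : z.Sm * z.Su ≤ z.Smu
  /-- FKG on `β` -/ cme : z.Sm * z.Se ≤ z.Sme
  /-- FKG on `β` -/ cmt : z.Sm * z.St ≤ z.Smt
  /-- FKG on `β` -/ cdu : z.Sd * z.Su ≤ z.Sdu
  /-- FKG on `β` -/ cde : z.Sd * z.Se ≤ z.Sde
  /-- FKG on `β` -/ cdt : z.Sd * z.St ≤ z.Sdt
  /-- FKG on `β` -/ cnu : z.Sn * z.Su ≤ z.Snu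
  /-- FKG on `β` -/ cne : z.Sn * z.Se ≤ z.Sne
  /-- FKG on `β` -/ cnt : z.Sn * z.St ≤ z.Snt
  /-- slack -/ a1u : 0 ≤ z.EA1u
  /-- slack -/ a1e : 0 ≤ z.EA1e
  /-- slack -/ a1t : 0 ≤ z.EA1t
  /-- slack -/ a2u : 0 ≤ z.EA2u
  /-- slack -/ a2e : 0 ≤ z.EA2e
  /-- slack -/ a2t : 0 ≤ z.EA2t
  /-- slack -/ c1m : 0 ≤ z.EmC1
  /-- slack -/ c1d : 0 ≤ z.EdC1
  /-- slack -/ c1n : 0 ≤ z.EnC1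
  /-- slack -/ c2m : 0 ≤ z.EmC2
  /-- slack -/ c2d : 0 ≤ z.EdC2
  /-- slack -/ c2n : 0 ≤ z.EnC2
  /-- slack -/ a1c1 : 0 ≤ z.EA1C1
  /-- slack -/ a1c2 : 0 ≤ z.EA1C2
  /-- slack -/ a2c1 : 0 ≤ z.EA2C1
  /-- slack -/ a2c2 : 0 ≤ z.EA2C2
  /-- slack -/ ea1 : 0 ≤ z.EA1
  /-- slack -/ ea2 : 0 ≤ z.EA2
  /-- slack -/ ec1 : 0 ≤ z.EC1
  /-- slack -/ ec2 : 0 ≤ z.EC2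

/-! ### The `T₁ + T₂ + T₃` split and the two free cases -/

/-- `E3 = T₁ + T₂ + T₃`: `T₁ = E[mC₁]+E[dC₂]+(Q₁−Q₂)E[A₁H]+Q₂E[A₂H]`, `T₂ = Cov(m,u)+Cov(m,e)+Cov(d,u)`,
`T₃ = E[A₁]E[C₁]+E[A₂]E[C₂]−E[A₁]E[C₂]`. [this work] -/
theorem E3_eq_T : z.E3 =
    (z.EmC1 + z.EdC2 + (z.Q1 - z.Q2) * (z.EA1u + z.EA1e + z.EA1t) + z.Q2 * (z.EA2u + z.EA2e + z.EA2t))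
    + ((z.Smu - z.Sm * z.Su) + (z.Sme - z.Sm * z.Se) + (z.Sdu - z.Sd * z.Su))
    + (z.EA1 * z.EC1 + z.EA2 * z.EC2 - z.EA1 * z.EC2) := by
  simp only [E3, EmC1, EdC2, EA1u, EA1e, EA1t, EA2u, EA2e, EA2t, EA1, EA2, EC1, EC2]; ring

variable {z}

/-- `T₁ + T₂ ≥ 0`. [this work] -/
theorem T12_nonneg (h : z.Bounds) :
    0 ≤ (z.EmC1 + z.EdC2 + (z.Q1 - z.Q2) * (z.EA1u + z.EA1e + z.EA1t) + z.Q2 * (z.EA2u + z.EA2e + z.EA2t))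
      + ((z.Smu - z.Sm * z.Su) + (z.Sme - z.Sm * z.Se) + (z.Sdu - z.Sd * z.Su)) := by
  have := h.c1m; have := h.c2d; have := h.a1u; have := h.a1e; have := h.a1t; have := h.a2u; have := h.a2e; have := h.a2t
  have := h.cmu; have := h.cme; have := h.cdu; have := h.hQ2; have := h.hQ21
  have h1 : 0 ≤ (z.Q1 - z.Q2) * (z.EA1u + z.EA1e + z.EA1t) := mul_nonneg (by linarith) (by linarith)
  have h2 : 0 ≤ z.Q2 * (z.EA2u + z.EA2e + z.EA2t) := mul_nonneg (by linarith) (by linarith)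
  linarith

/-- **Free case 1: `E[C₂] ≤ E[C₁]` (i.e. `Cov(ψ₂,h) ≤ Cov(ψ₁,h)` on `α×β`) ⇒ `E3 ≥ 0`.** [this work] -/
theorem E3_nonneg_of_EC_le (h : z.Bounds) (hc : z.EC2 ≤ z.EC1) : 0 ≤ z.E3 := by
  rw [E3_eq_T]
  have hT := T12_nonneg h
  have h3 : 0 ≤ z.EA1 * (z.EC1 - z.EC2) := mul_nonneg h.ea1 (by linarith)
  have h4 : 0 ≤ z.EA2 * z.EC2 := mul_nonneg h.ea2 h.ec2
  nlinarith

/-- **Free case 2: `E[A₁] ≤ E[A₂]` (i.e. `Cov(φ₁,g) ≤ Cov(φ₂,g)` on `γ×β`) ⇒ `E3 ≥ 0`.** [this work] -/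
theorem E3_nonneg_of_EA_le (h : z.Bounds) (ha : z.EA1 ≤ z.EA2) : 0 ≤ z.E3 := by
  rw [E3_eq_T]
  have hT := T12_nonneg h
  have h3 : 0 ≤ (z.EA2 - z.EA1) * z.EC2 := mul_nonneg (by linarith) h.ec2
  have h4 : 0 ≤ z.EA1 * z.EC1 := mul_nonneg h.ea1 h.ec1
  nlinarith

/-! ### Identities A and B: the region `Q₂ ≤ P₁Q₁ + P₂Q₂` -/

/-- IDENTITY A: `P₂Q₁·E3` as 14 products (all signed but the `κ·E[dC₁]` term, `κ = P₂(P₁Q₁ − (1−P₂+P₁)Q₂)`). [this work] -/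
theorem identityA : z.P2 * z.Q1 * z.E3 =
    z.P1 * z.Q2 * (z.Sde - z.Sd * z.Se) + (z.Q1 * (z.P2 - z.P1) + z.P1 * z.Q2) * (z.Sdu - z.Sd * z.Su)
    + (z.P2 * (z.Q1 - z.Q2) + z.P1 * z.Q2) * (z.Sme - z.Sm * z.Se) + (z.P2 * z.Q1 + (z.P2 - z.P1) * (z.Q1 - z.Q2)) * (z.Smu - z.Sm * z.Su)
    + z.P2 * z.Q1 * z.EA1e + z.P2 * (z.Q1 - z.Q2) * (z.EA1 * z.EC1) + (z.P2 - z.P1) * z.Q2 * z.EA2e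
    + ((z.P2 - z.P1) * z.Q2 + z.P1 * z.Q1) * z.EA2u + z.P1 * z.Q2 * (z.EA2 * z.EC1) + (z.P2 - z.P1) * z.Q1 * (z.EA2 * z.EC2)
    + z.P2 * (z.P1 * z.Q1 - (1 - z.P2 + z.P1) * z.Q2) * z.EdC1 + z.P2 * z.Q1 * z.EdC2
    + z.P2 * ((z.P2 - z.P1) * z.Q2 + z.P1 * z.Q1) * (z.EmC1 + z.EnC1) := by
  simp only [E3, EA1e, EA1, EC1, EA2e, EA2u, EA2, EC2, EdC1, EdC2, EmC1, EnC1]; ring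

/-- IDENTITY B: `P₁P₂Q₁·E3` as 14 products (signed but the `−κ·E[A₁C₁]` and `P₂(P₁Q₁+P₂Q₂−Q₂)·E[mC₁]` terms). [this work] -/
theorem identityB : z.P1 * z.P2 * z.Q1 * z.E3 =
    z.P1 * (z.P1 * z.Q2) * (z.Sde - z.Sd * z.Se) + z.P1 * (z.Q1 * (z.P2 - z.P1) + z.P1 * z.Q2) * (z.Sdu - z.Sd * z.Su)
    + z.P1 * (z.P2 * (z.Q1 - z.Q2) + z.P1 * z.Q2) * (z.Sme - z.Sm * z.Se)
    + z.P1 * (z.P2 * z.Q1 + (z.P2 - z.P1) * (z.Q1 - z.Q2)) * (z.Smu - z.Sm * z.Su)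
    + z.P2 * ((1 - z.P2 + z.P1) * z.Q2 - z.P1 * z.Q1) * z.EA1C1
    + z.P1 * (z.P2 * z.Q1) * z.EA1e + z.P1 * (z.P2 * (z.Q1 - z.Q2)) * (z.EA1 * z.EC1) + z.P1 * ((z.P2 - z.P1) * z.Q2) * z.EA2e
    + z.P1 * ((z.P2 - z.P1) * z.Q2 + z.P1 * z.Q1) * z.EA2u + z.P1 * (z.P1 * z.Q2) * (z.EA2 * z.EC1)
    + z.P1 * ((z.P2 - z.P1) * z.Q1) * (z.EA2 * z.EC2) + z.P1 * (z.P2 * z.Q1) * z.EdC2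
    + z.P2 * (z.P1 * z.Q1 + z.P2 * z.Q2 - z.Q2) * z.EmC1 + z.P1 * (z.P2 * z.Q2) * z.EnC1 := by
  simp only [E3, EA1C1, EA1e, EA1, EC1, EA2e, EA2u, EA2, EC2, EdC2, EmC1, EnC1]; ring

/-- Region A: `(1−P₂+P₁)Q₂ ≤ P₁Q₁` (with `P₂, Q₁ > 0`) ⇒ `E3 ≥ 0`. [this work] -/
theorem E3_nonneg_of_regionA (h : z.Bounds) (hP2 : 0 < z.P2) (hQ1 : 0 < z.Q1)
    (hκ : (1 - z.P2 + z.P1) * z.Q2 ≤ z.P1 * z.Q1) : 0 ≤ z.E3 := by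
  have hP1 := h.hP1; have hP12 := h.hP12; have hP2' := h.hP2; have hQ2 := h.hQ2; have hQ21 := h.hQ21
  have hR : 0 ≤ z.P2 - z.P1 := by linarith
  have hRq : 0 ≤ z.Q1 - z.Q2 := by linarith
  have cde : 0 ≤ z.Sde - z.Sd * z.Se := by linarith [h.cde]
  have cdu : 0 ≤ z.Sdu - z.Sd * z.Su := by linarith [h.cdu]
  have cme : 0 ≤ z.Sme - z.Sm * z.Se := by linarith [h.cme]
  have cmu : 0 ≤ z.Smu - z.Sm * z.Su := by linarith [h.cmu]
  have key : 0 ≤ z.P2 * z.Q1 * z.E3 := by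
    rw [identityA]
    have t1 : 0 ≤ z.P1 * z.Q2 * (z.Sde - z.Sd * z.Se) := by positivity
    have t2 : 0 ≤ (z.Q1 * (z.P2 - z.P1) + z.P1 * z.Q2) * (z.Sdu - z.Sd * z.Su) := by positivity
    have t3 : 0 ≤ (z.P2 * (z.Q1 - z.Q2) + z.P1 * z.Q2) * (z.Sme - z.Sm * z.Se) := by positivity
    have t4 : 0 ≤ (z.P2 * z.Q1 + (z.P2 - z.P1) * (z.Q1 - z.Q2)) * (z.Smu - z.Sm * z.Su) := by positivity
    have t5 : 0 ≤ z.P2 * z.Q1 * z.EA1e := by have := h.a1e; positivity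
    have t6 : 0 ≤ z.P2 * (z.Q1 - z.Q2) * (z.EA1 * z.EC1) := by have := h.ea1; have := h.ec1; positivity
    have t7 : 0 ≤ (z.P2 - z.P1) * z.Q2 * z.EA2e := by have := h.a2e; positivity
    have t8 : 0 ≤ ((z.P2 - z.P1) * z.Q2 + z.P1 * z.Q1) * z.EA2u := by have := h.a2u; positivity
    have t9 : 0 ≤ z.P1 * z.Q2 * (z.EA2 * z.EC1) := by have := h.ea2; have := h.ec1; positivity
    have t10 : 0 ≤ (z.P2 - z.P1) * z.Q1 * (z.EA2 * z.EC2) := by have := h.ea2; have := h.ec2; positivity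
    have t11 : 0 ≤ z.P2 * (z.P1 * z.Q1 - (1 - z.P2 + z.P1) * z.Q2) * z.EdC1 :=
      mul_nonneg (mul_nonneg hP2.le (by linarith)) h.c1d
    have t12 : 0 ≤ z.P2 * z.Q1 * z.EdC2 := by have := h.c2d; positivity
    have t13 : 0 ≤ z.P2 * ((z.P2 - z.P1) * z.Q2 + z.P1 * z.Q1) * (z.EmC1 + z.EnC1) := by
      have := h.c1m; have := h.c1n; positivity
    linarith
  nlinarith [key, mul_pos hP2 hQ1]

/-- Region B: `P₁Q₁ ≤ (1−P₂+P₁)Q₂` and `Q₂ ≤ P₁Q₁ + P₂Q₂` (with `P₁, Q₁ > 0`) ⇒ `E3 ≥ 0`. [this work] -/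
theorem E3_nonneg_of_regionB (h : z.Bounds) (hP1 : 0 < z.P1) (hQ1 : 0 < z.Q1)
    (hκ : z.P1 * z.Q1 ≤ (1 - z.P2 + z.P1) * z.Q2) (hreg : z.Q2 ≤ z.P1 * z.Q1 + z.P2 * z.Q2) : 0 ≤ z.E3 := by
  have hP0 := h.hP1; have hP12 := h.hP12; have hP2' := h.hP2; have hQ2 := h.hQ2; have hQ21 := h.hQ21
  have hP2 : 0 < z.P2 := lt_of_lt_of_le hP1 hP12
  have hR : 0 ≤ z.P2 - z.P1 := by linarith
  have hRq : 0 ≤ z.Q1 - z.Q2 := by linarith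
  have cde : 0 ≤ z.Sde - z.Sd * z.Se := by linarith [h.cde]
  have cdu : 0 ≤ z.Sdu - z.Sd * z.Su := by linarith [h.cdu]
  have cme : 0 ≤ z.Sme - z.Sm * z.Se := by linarith [h.cme]
  have cmu : 0 ≤ z.Smu - z.Sm * z.Su := by linarith [h.cmu]
  have key : 0 ≤ z.P1 * z.P2 * z.Q1 * z.E3 := by
    rw [identityB]
    have t1 : 0 ≤ z.P1 * (z.P1 * z.Q2) * (z.Sde - z.Sd * z.Se) := by positivity
    have t2 : 0 ≤ z.P1 * (z.Q1 * (z.P2 - z.P1) + z.P1 * z.Q2) * (z.Sdu - z.Sd * z.Su) := by positivity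
    have t3 : 0 ≤ z.P1 * (z.P2 * (z.Q1 - z.Q2) + z.P1 * z.Q2) * (z.Sme - z.Sm * z.Se) := by positivity
    have t4 : 0 ≤ z.P1 * (z.P2 * z.Q1 + (z.P2 - z.P1) * (z.Q1 - z.Q2)) * (z.Smu - z.Sm * z.Su) := by positivity
    have t5 : 0 ≤ z.P2 * ((1 - z.P2 + z.P1) * z.Q2 - z.P1 * z.Q1) * z.EA1C1 :=
      mul_nonneg (mul_nonneg hP2.le (by linarith)) h.a1c1
    have t6 : 0 ≤ z.P1 * (z.P2 * z.Q1) * z.EA1e := by have := h.a1e; positivity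
    have t7 : 0 ≤ z.P1 * (z.P2 * (z.Q1 - z.Q2)) * (z.EA1 * z.EC1) := by have := h.ea1; have := h.ec1; positivity
    have t8 : 0 ≤ z.P1 * ((z.P2 - z.P1) * z.Q2) * z.EA2e := by have := h.a2e; positivity
    have t9 : 0 ≤ z.P1 * ((z.P2 - z.P1) * z.Q2 + z.P1 * z.Q1) * z.EA2u := by have := h.a2u; positivity
    have t10 : 0 ≤ z.P1 * (z.P1 * z.Q2) * (z.EA2 * z.EC1) := by have := h.ea2; have := h.ec1; positivity
    have t11 : 0 ≤ z.P1 * ((z.P2 - z.P1) * z.Q1) * (z.EA2 * z.EC2) := by have := h.ea2; have := h.ec2; positivity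
    have t12 : 0 ≤ z.P1 * (z.P2 * z.Q1) * z.EdC2 := by have := h.c2d; positivity
    have t13 : 0 ≤ z.P2 * (z.P1 * z.Q1 + z.P2 * z.Q2 - z.Q2) * z.EmC1 :=
      mul_nonneg (mul_nonneg hP2.le (by linarith)) h.c1m
    have t14 : 0 ≤ z.P1 * (z.P2 * z.Q2) * z.EnC1 := by have := h.c1n; positivity
    linarith
  nlinarith [key, mul_pos (mul_pos hP1 hP2) hQ1]

/-- Regions A ∪ B: `Q₂ ≤ P₁Q₁ + P₂Q₂` (with `P₁, Q₁ > 0`) ⇒ `E3 ≥ 0`. [this work] -/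
theorem E3_nonneg_of_Q2_le (h : z.Bounds) (hP1 : 0 < z.P1) (hQ1 : 0 < z.Q1)
    (hreg : z.Q2 ≤ z.P1 * z.Q1 + z.P2 * z.Q2) : 0 ≤ z.E3 := by
  rcases le_total ((1 - z.P2 + z.P1) * z.Q2) (z.P1 * z.Q1) with hκ | hκ
  · exact E3_nonneg_of_regionA h (lt_of_lt_of_le hP1 h.hP12) hQ1 hκ
  · exact E3_nonneg_of_regionB h hP1 hQ1 hκ hreg

/-! ### The `c ↔ a` swap symmetry and the region `P₁ ≤ P₁Q₁ + P₂Q₂` -/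

variable (z)

/-- The swap `(φ₁,φ₂;ψ₁,ψ₂;g;h) ↦ (ψ₂,ψ₁;φ₂,φ₁;h;g)` (`f = ψ₂φ₂ + (ψ₁−ψ₂)φ₁` read from the `a` side) on atoms. [this work] -/
def swap : Atoms :=
  ⟨z.Q2, z.Q1, z.P2, z.P1, z.Smu, z.Sdu, z.Snu, z.Sme, z.Sde, z.Sne, z.Smt, z.Sdt, z.Snt, z.Su, z.Se, z.St, z.Sm, z.Sd, z.Sn⟩

/-- `E3` is swap-invariant. [this work] -/
theorem E3_swap : z.swap.E3 = z.E3 := by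
  simp only [E3, swap]; ring

variable {z}

/-- `Bounds` is swap-invariant. [this work] -/
theorem Bounds.swap (h : z.Bounds) : z.swap.Bounds where
  hP1 := h.hQ2
  hP12 := h.hQ21
  hP2 := h.hQ1
  hQ2 := h.hP1
  hQ21 := h.hP12
  hQ1 := h.hP2
  smu := h.smu
  sme := h.sdu
  smt := h.snu
  sdu := h.sme
  sde := h.sde
  sdt := h.sne
  snu := h.smt
  sne := h.sdt
  snt := h.snt
  sm := h.su
  sd := h.se
  sn := h.st
  su := h.sm
  se := h.sd
  st := h.sn
  cmu := by have := h.cmu; simp only [Atoms.swap]; linarith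
  cme := by have := h.cdu; simp only [Atoms.swap]; linarith
  cmt := by have := h.cnu; simp only [Atoms.swap]; linarith
  cdu := by have := h.cme; simp only [Atoms.swap]; linarith
  cde := by have := h.cde; simp only [Atoms.swap]; linarith
  cdt := by have := h.cne; simp only [Atoms.swap]; linarith
  cnu := by have := h.cmt; simp only [Atoms.swap]; linarith
  cne := by have := h.cdt; simp only [Atoms.swap]; linarith
  cnt := by have := h.cnt; simp only [Atoms.swap]; linarith
  a1u := by have := h.c2m; simp only [Atoms.swap, EA1u, EmC2] at this ⊢; linarith
  a1e := by have := h.c2d; simp only [Atoms.swap, EA1e, EdC2] at this ⊢; linarith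
  a1t := by have := h.c2n; simp only [Atoms.swap, EA1t, EnC2] at this ⊢; linarith
  a2u := by have := h.c1m; simp only [Atoms.swap, EA2u, EmC1] at this ⊢; linarith
  a2e := by have := h.c1d; simp only [Atoms.swap, EA2e, EdC1] at this ⊢; linarith
  a2t := by have := h.c1n; simp only [Atoms.swap, EA2t, EnC1] at this ⊢; linarith
  c1m := by have := h.a2u; simp only [Atoms.swap, EmC1, EA2u] at this ⊢; linarith
  c1d := by have := h.a2e; simp only [Atoms.swap, EdC1, EA2e] at this ⊢; linarith
  c1n := by have := h.a2t; simp only [Atoms.swap, EnC1, EA2t] at this ⊢; linarith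
  c2m := by have := h.a1u; simp only [Atoms.swap, EmC2, EA1u] at this ⊢; linarith
  c2d := by have := h.a1e; simp only [Atoms.swap, EdC2, EA1e] at this ⊢; linarith
  c2n := by have := h.a1t; simp only [Atoms.swap, EnC2, EA1t] at this ⊢; linarith
  a1c1 := by have := h.a2c2; simp only [Atoms.swap, EA1C1, EA2C2] at this ⊢; linarith
  a1c2 := by have := h.a1c2; simp only [Atoms.swap, EA1C2] at this ⊢; linarith
  a2c1 := by have := h.a2c1; simp only [Atoms.swap, EA2C1] at this ⊢; linarith
  a2c2 := by have := h.a1c1; simp only [Atoms.swap, EA2C2, EA1C1] at this ⊢; linarith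
  ea1 := by have := h.ec2; simp only [Atoms.swap, EA1, EC2] at this ⊢; linarith
  ea2 := by have := h.ec1; simp only [Atoms.swap, EA2, EC1] at this ⊢; linarith
  ec1 := by have := h.ea2; simp only [Atoms.swap, EC1, EA2] at this ⊢; linarith
  ec2 := by have := h.ea1; simp only [Atoms.swap, EC2, EA1] at this ⊢; linarith

/-- Dual region: `P₁ ≤ P₁Q₁ + P₂Q₂` (with `P₂, Q₂ > 0`) ⇒ `E3 ≥ 0`. [this work] -/
theorem E3_nonneg_of_P1_le (h : z.Bounds) (hP2 : 0 < z.P2) (hQ2 : 0 < z.Q2)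
    (hreg : z.P1 ≤ z.P1 * z.Q1 + z.P2 * z.Q2) : 0 ≤ z.E3 := by
  rw [← E3_swap]
  refine E3_nonneg_of_Q2_le h.swap hQ2 hP2 ?_
  simp only [Atoms.swap]; linarith

/-- **THEOREM (atom level).** `min(P₁, Q₂) ≤ P₁Q₁ + P₂Q₂` (with `P₁, Q₂ > 0`) ⇒ `E3 ≥ 0`.  In particular whenever `P₂ ≥ 1/2` and
`Q₁ ≥ 1/2`, or `P₂ = 1`, or `Q₁ = 1`. [this work] -/
theorem E3_nonneg_of_min_le (h : z.Bounds) (hP1 : 0 < z.P1) (hQ2 : 0 < z.Q2)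
    (hreg : min z.P1 z.Q2 ≤ z.P1 * z.Q1 + z.P2 * z.Q2) : 0 ≤ z.E3 := by
  rcases min_choice z.P1 z.Q2 with hm | hm <;> rw [hm] at hreg
  · exact E3_nonneg_of_P1_le h (lt_of_lt_of_le hP1 h.hP12) hQ2 hreg
  · exact E3_nonneg_of_Q2_le h hP1 (lt_of_lt_of_le hQ2 h.hQ21) hreg

end Atoms

end SahiTriangleStaircaseTwo

end Summit.CriticalPhenomena.PercolationContinuityZ3.Theorems
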